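import Mathlib
import HarnessLib
import HarnessLib.Audit
import Summits.SmoothPoincare4.Statement
import Literature.Topology.FourManifolds.SmoothTriangulation
import HarnessLib.Audit.Status.Attr

/-!
Route: TropicalFanoSkeleton

# Route TropicalFanoSkeleton — Tropical fake balls collapse — positive integral tropical fan data
plus the MMP (rescue of LogCYSkeleton)

RESCUE of the retired route LogCYSkeleton (killed by NonMax: the sextic 5-fold witness has a
standard dual complex at maximal birational
complexity). It suffices to show X = TropicalBall ∧ TropicalCollapse. PUNCTURE FIRST: a smooth
homotopy 4-sphere M, smoothly triangulated by K
with a chosen vertex v₀, is standard iff the antistar of v₀ (a PL homotopy 4-BALL) has a collapsible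
subdivision. TropicalBall (existence half,
⇔ SPC4 given the rest): some (K, v₀) carries POSITIVE INTEGRAL TROPICAL FAN DATA — integer edge
vectors x a w ∈ ℤ⁴ at every vertex a ≠ v₀ making
the star of a in K a complete, projective, unimodular simplicial fan (v₀ enters only as a ray
direction: it is the vertex at infinity), such that
every codimension-one transition monodromy is a Gross–Siebert POSITIVE SHEAR T = id + κ⟨·,ď_ρ⟩d_ω, κ
≥ 0 — exactly the discrete data of the fan
picture of a non-compact tropical 4-manifold B = |K| ∖ v₀ whose bounded core is the fake ball and
whose one end is conical over lk(v₀) = S³.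
TropicalCollapse (rigidity half, a purely combinatorial statement with an algebro-geometric proof
plan): such data on a vertex-antistar of ANY
smoothly triangulated closed 4-manifold force a skeleton certificate (a smooth triangulation with a
vertex whose antistar collapses), because
Gross–Siebert reconstruction turns the data into a toric degeneration whose general fibre is a
4-fold with effective anticanonical divisor
(Fano type, rationally connected) and whose special fibre has dual complex = the core, and de
Fernex–Kollár–Xu's MMP theorem then COLLAPSES
that dual complex — no complexity hypothesis, hence no NonMax.
Lean: `Summit.SmoothPoincare4.SmoothPoincare4.Theses.TropicalFanoSkeleton.TropicalBall ∧
Summit.SmoothPoincare4.SmoothPoincare4.Theses.TropicalFanoSkeleton.TropicalCollapse`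

## Assembly
Pure logic (sorry-free in the planner's Sketch.lean; to be certified by `ledger route check
--native`): `SmoothPoincare4` unfolds to
∀ M (Hausdorff, second countable) [C^∞ atlas on ℝ⁴], M ≃ₕ S⁴ → Nonempty (M ≃ₘ S⁴); TropicalBall
gives (K, v₀, x) on M, TropicalCollapse turns it
into a skeleton certificate, CertificateRecognition returns the diffeomorphism:
`theorem closes (hTB : TropicalBall) (hTC : TropicalCollapse) (hR : CertificateRecognition) :
SmoothPoincare4 := by intro M _ _ _ _ _ e; obtain ⟨N, K, h, hK, v₀, hv₀, x, hx⟩ := hTB M e; exact hR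
M (hTC M N K h hK v₀ hv₀ x hx)`.
Upstream (informal, AG, filed as items after open): FanoSmoothing ∧ RcGeneralFibre ∧
SkeletonComparison ∧ [dFKX Thm 41, cite] ⇒ TropicalCollapse.

Rationale: WHY THIS LINE. The corpse's engine (an MMP step positive on a boundary divisor collapses the dual
complex, FernexKollarXu2012 Thm 19) is sound; what died was
the way to feed it (low birational complexity of a log Calabi–Yau realisation of the SPHERE). The
missing hypothesis is RATIONAL CONNECTEDNESS,
and it becomes available once one realises the punctured sphere instead: for a projective morphism f
: X → C from a smooth 5-fold with snc
special fibre and rationally connected general fibres, D(red f⁻¹(0)) is collapsible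
(FernexKollarXu2012 Thm 4 = Thm 41, proof p.14: BCHM
termination over C, Cor 22 collapses, induction through the Fano contraction; Cor 24(2) is the
klt-singularity twin), a printed theorem; by
Loginov2019 Thm 1 the realisation must NOT be a Fano family with −K relatively ample (those have
simplex dual complexes), which is exactly the
regime of toric/Gross–Siebert degenerations. Imported: mirror symmetry's reconstruction theorem
(GrossSiebert2011 Thm 1 / Thm 1.29: positive,
simple, pre-polarised tropical data with bounded intersection-complex cells ⇒ formal toric
degeneration of the pair; Cor 1.30/Ruddat–Siebert
for algebraisation; FeltenFilipRuddat2021, Prince2019 for the non-simple frontier),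
higher-dimensional MMP (BCHM, dFKX, HX09), and PL topology
(Whitehead1939: collapsible combinatorial manifold = ball). New relative to every open route (none
uses complex algebraic or tropical
geometry; grep of 54 Theses) and to the corpse: the realisation object is the BALL with a vertex at
infinity, the certificate-producing
theorem is dFKX Thm 41 instead of the refuted NonMax, and the typed layer is new — a finite integer
datum on the triangulation (fan charts +
positive shears) whose two halves TropicalBall / TropicalCollapse are both typed and both used by
`closes`.

RANKED CRUXES. #2 TropicalCollapse (crux) — For every closed smooth 4-manifold M, every smooth
triangulation K of M, every vertex v₀ and every positive integral tropical fan datum x on (K, v₀) —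
integrality, x a a = 0, complete projective unimodular simplicial fans at all vertices a ≠ v₀ (cones
generated by the chart positions x a w of the other vertices of each face, v₀ contributing its ray),
and for every codimension-one face ρ with cofaces σ⁺ ≠ σ⁻ and vertices a ≠ b of ρ (both ≠ v₀) the
transition monodromy (chart a → chart b through σ⁺, back through σ⁻) is y ↦ y + κ·ď_ρ(y)·(x a b)
with κ ≥ 0, ď_ρ the primitive conormal of ρ positive on σ⁺ — M admits a skeleton certificate: a
smooth triangulation K′ with a vertex whose antistar simplicially collapses to a vertex. Plan: GS
reconstruction → RC general fibre → dFKX Thm 41 → comparison (informal items FanoSmoothing,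
RcGeneralFibre, SkeletonComparison filed after open). [difficulty: open-problem] (why it might fail:
Positive but NON-SIMPLE / non-polarisable data (the calibration has κ = 5) need not come from a
degeneration (GS need simplicity + pre-polarisation + log structure, logmirror Thm 5.2/5.4); such
data on M ∖ pt for some M ≄ S⁴ would refute the typed form while the AG chain survives.)
[GrossSiebert2011, FernexKollarXu2012, Loginov2019, FeltenFilipRuddat2021, Prince2019,
arXiv:math/0309070, Whitehead1939]
#3 TropicalBall (crux) — Every smooth homotopy 4-sphere M admits a smooth triangulation K, a vertex
v₀ and a positive integral tropical fan datum x on (K, v₀) (same clauses as in TropicalCollapse).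
The existence half: an existence-of-geometric-structure problem (integral affine structure with
codimension-2 singularities and one conical end) on the punctured fake sphere; flexible away from
the discriminant (h-principle for affine immersions of open parallelisable 4-manifolds), rigid only
through the finite shear data. [difficulty: open-problem] (why it might fail: Zero slack — with
TropicalCollapse and recognition it implies SPC4, so a fake ball carries no such data; no mechanism
yet produces fan data from a handle decomposition, and even for S⁴ only the ∂Δ⁵ / quintic-4-fold
structure (κ = 5) is in hand.) [GrossSiebert2011, arXiv:math/0309070, FernexKollarXu2012,
MauriMoraga2024]
#9 CertificateRecognition (support) — RECOGNITION (known; verbatim the LogCYSkeleton item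
stmt-SmoothPoincare4-13642): a smooth 4-manifold smoothly triangulated by a finite complex with a
vertex whose antistar simplicially collapses to a vertex is diffeomorphic to S⁴ (Whitehead:
collapsible combinatorial manifold = PL ball; cone on the PL 3-sphere link = ball; Alexander; PL =
DIFF in dimension 4). [difficulty: XL] [Whitehead1939, RourkeSanderson1972, HirschMazur1974,
Lange2016]
#9 SimplexTropicalCalibration (support) — CALIBRATION / non-vacuity: the round S⁴ carries positive
integral tropical fan data — K = ∂Δ⁵ radially projected (the smooth triangulation of
SimplexBoundaryCertificate, stmt-SmoothPoincare4-13643), v₀ any vertex, and at each other vertex the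
fan of ℙ⁴ (the four core neighbours ↦ e₁,…,e₄, v₀ ↦ −Σeᵢ); all transition monodromies are shears
with κ = 5 ≥ 0 (checked by hand for both types of codimension-one faces; it is the toric
degeneration t·f₅ + u₀⋯u₄ = 0 of quintic 4-folds with D = {u₅ = 0} a quintic Calabi–Yau 3-fold ↔
lk(v₀) = S³). [difficulty: L] [GrossSiebert2011, Whitehead1940, MauriMoraga2024]

TWO-LAYER PLAN. Foreseen glued splits (k ≤ 3, depth 1; nothing filed now): TropicalCollapse ⇐
FanoSmoothing (typed once D-trop/D2 land: data ⇒ projective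
toric degeneration over ℂ⟦t⟧ with special-fibre dual complex = antistar(v₀), general fibre proper
with effective anticanonical divisor ↔ v₀)
→ RcCollapse (RC general fibre + dFKX Thm 41 + comparison ⇒ antistar has a collapsible subdivision)
→ TropicalCollapse (subdivision ⇒
certificate on a refined smooth triangulation). TropicalBall ⇐ LocalFans (every PL 4-ball admits
complete projective unimodular fan
structures at all vertices after subdivision — links are PL 3-spheres; provable) → ShearExtension
(the global CSP: choose the charts so that
all codimension-one monodromies are positive shears) → TropicalBall. CertificateRecognition ⇐
AntistarIsPLManifold → CollapsibleManifoldIsBall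
→ TwoBallsSmoothing (as in the corpse).

KILL CRITERIA. TropicalCollapse REFUTED by positive tropical fan data on a vertex-antistar of a
smooth triangulation of some closed M ≄ S⁴ (e.g. Kühnel's
9-vertex ℂℙ², S²×S², S¹×S³): if the refuting data are non-simple / non-polarisable, restate with GS
simplicity (logmirror Def 1.60) and a
global pre-polarisation added (one repair); if they are simple and polarised, the AG chain itself is
broken (RC or comparison fails) — close
refuted:TropicalCollapse and hand "positive tropical 4-manifolds with conical S³ end need not be
balls" to the barrier catalogue. TropicalBall
can only be refuted together with SPC4; it is retired `exhausted` if ShearExtension is shown to be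
obstructed by an invariant that is
non-zero on some honest ball triangulation family with no refinement escaping it. A proof of SPC4
elsewhere moots the route; a proof that
every PL 4-ball carries positive simple tropical data after subdivision PROVES SPC4 through this
route.

NOT DECOMPOSED YET. The AG layer (FanoSmoothing, RcGeneralFibre, SkeletonComparison) stays informal
until the definition requests land (no Lean vocabulary for
toric degenerations, dlt/qdlt pairs, dual complexes, rational connectedness); GS simplicity / local
rigidity and the global pre-polarisation
are deliberately NOT in the typed data (the typed TropicalCollapse is the bold form; simplicity is
the first repair knob); the PL plumbing of
CertificateRecognition; the subdivision lemma "collapsible subdivision of an antistar ⇒ certificate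
on a refined smooth triangulation".

CHEAPEST FALSIFIER. (1) DONE by hand, survived: positivity/sign convention of the typed shear clause
on the calibration structure (∂Δ⁵, ℙ⁴-fans): for ρ ⊂ core,
T(y) = y + 5·y₄·e₁ (κ = 5, ď = y₄ positive on the core simplex's extra generator e₄); for ρ ∋ v₀,
T(y) = y + 5(y₃ − y₄)e₁ with ď = y₃ − y₄
vanishing on span{e₁, e₂, r}, positive on e₃ (κ = 5) — both orderings of σ± give κ = 5 ≥ 0. (2)
OWED, kit-able integer CSP (minutes on the
farm, not run this session): search positive tropical fan data (edge vectors in a box [−3,3]⁴,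
unimodular dets, complete fans, shear
conditions) on Kühnel's ℂℙ²₉ minus a vertex (8 charts × 8 neighbours, 160 det constraints) and on
small S²×S² / S¹×S³ triangulations (Lutz's
library); any solution refutes TropicalCollapse as typed. (3) Lookup owed: does any uniruled non-RC
smooth projective 4-fold with an irreducible
anticanonical Calabi–Yau divisor admit a positive toric degeneration of the pair (would break
RcGeneralFibre)?

NUMBERS. dFKX (arXiv:1212.1675): Thm 41 (RC general fibre, qdlt) ⇒ D(F₀) contractible, collapsible
in the smooth projective snc case (proof p.14);
Cor 24(2): klt + ℚ-factorial ⇒ D(E) collapsible; Thm 19: (D₀·R) > 0 for a component D₀ of Δ⁼¹ ⇒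
elementary collapses of star-type/link-type
pairs. Loginov2019 Thm 1/12: semistable families with −K_X π-ample have dual complex Δᵏ, k ≤ n (so
toric realisations have −K not relatively
ample). GS2011: positivity Def 1.4 (κ_ωρ ≥ 0), monodromy T_ωρ(m) = m + κ⟨m, ď_ρ⟩d_ω (§1.1), Thm 1.29
needs locally rigid (⇐ simple) +
positive + pre-polarised + bounded intersection-complex cells; Ex 1.11: cubic surface, κ = 3 at
three points. Calibration: κ = 5 (quintic
4-fold), f-vector of ∂Δ⁵ = (6,15,20,15,6), each vertex fan = fan of ℙ⁴ (5 unimodular cones). Typed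
data size on a triangulation with f₀
vertices and mean degree d: 4·f₀·d integers.

DEFINITION REQUESTS. D-trop (kind definition, topic Literature/AlgebraicGeometry/TropicalManifolds;
definable NOW, it is the helper def of Sketch.lean, and would
shorten both cruxes tenfold): `IsPositiveTropicalFanData K v₀ x` (integrality, fan axioms via the
cone sets, local projectivity, positive
shear monodromy) + `coneAt`; later: GS simplicity (logmirror Def 1.60) and multivalued
pre-polarisation as predicates on the same data.
D2 (the corpse's request, still wanted): dlt/qdlt pair, dual complex of a dlt pair as a regular
Δ-complex, rationally connected variety,
toric degeneration of a pair — unblocks typing FanoSmoothing / RcGeneralFibre / SkeletonComparison.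
Cite facts wanted: FernexKollarXu2012
Thm 41 + Cor 22/24; GrossSiebert2011 Thm 1.29 / Cor 1.30; Loginov2019 Thm 1; Whitehead1939
(collapsible PL manifold is a ball,
RourkeSanderson1972 Cor 3.27).

Novelty: Searches (2026-08-16, this seat; local searchd DOWN, OpenAlex/S2 429): `lit search --source zbmath`
"dual complex Fano degeneration" (7:
Loginov2019 = arXiv:1909.08319 READ pp.2-6; CarlPumperlaSiebert arXiv:2205.07753; Lee
arXiv:2304.10625), "tropical manifold four-dimensional"
(1: Prince2019 arXiv:1909.02140, grepped), "dual complex degeneration rationally connected" (1: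
dFKX), "affine manifold singularities exotic
four-manifold" (0), "Gross-Siebert reconstruction Fano toric degeneration dual complex contractible"
(0), "dual complex Whitehead collapsible
PL ball degeneration" (0); `lit search --source arxiv` "homotopy 4-sphere exotic smooth structure"
(5: FKL arXiv:2401.03498 READ, Gompf
arXiv:1110.1865), three further arxiv queries (0); `lit vsearch` "dual complex of dlt degeneration
of RC varieties collapsible" (12 books,
none relevant); `lit galaxy search --star all` "smooth 4-dimensional Poincaré conjecture" (5, none
AG) and "dual intersection complex" (9:
GS, GHK, Barrott — mirror symmetry only); READ arXiv:1212.1675 pp.2-3, 8-10, 14 and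
arXiv:math/0703822 pp.3-4, 8-9, 11, 17-18, 34; grep of all
54 SPC4 Theses and 160 cards for tropical / Gross–Siebert / dual complex / MMP (only the corpse and
its card; real-rational-loci-transcendental
uses RC for REAL loci, a different mechanism); `ledger negatives --problem SmoothPoincare4` (0).
Nearest prior art found: FernexKollarXu2012 Thm 41 / Cor 24 (the engine, never pointed at PL
recognition), GrossSiebert2011 Thm 1.29 (the
re  [refs: 1909.08319, 2205.07753, 2304.10625, 1909.02140, 2401.03498, 1110.1865, 1212.1675, math/0703822, Loginov2019, Prince2019, FernexKollarXu2012, GrossSiebert2011, MauriMoraga2024, KollarXu2015]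

Barriers (technique_class: tropical-affine, birational-mmp, pl-collapse): - technique_class: tropical-affine, birational-mmp, pl-collapse
- Literature.Barriers.SmoothPoincare4.GaugeSumBarrierFour: outside the class — no invariant of Σ or
Σ # Y is computed; the output is a collapse sequence read off an auxiliary degeneration.
- Literature.Barriers.SmoothPoincare4.StableBarrierFour: no stabilisation anywhere; likewise
HCobordismInvariantBarrierFour (nothing factors through the h-cobordism class) and
GluckTwistCP2Barrier (no ℂℙ²-sum).
- Literature.Barriers.SmoothPoincare4.TopologicalBarrierFour: evaded by construction — the data live
on a SMOOTH (Whitehead) triangulation; on a merely topological triangulation TropicalCollapse +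
recognition would contain SPC4.
- Literature.Barriers.SmoothPoincare4.TwistedSphereBarrierFour: not leaned on — the final gluing is
PL ball ∪ cone, Alexander trick; Γ₄ = 0 unused.
- Literature.Barriers.SmoothPoincare4.HCobordismBarrierFour: not invoked — no h-cobordism, handle
trading or cork argument.
- Literature.Barriers.SmoothPoincare4.ContractibleBarrierFour: not contradicted — TropicalCollapse
speaks only of vertex antistars (boundary S³) and asserts nothing for Mazur-type contractible
pieces; RelativeContractibleBarrierFour likewise.
- Literature.Barriers.SmoothPoincare4.OpenAnalogueBarrierFour: not used — nothing is concluded from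
"homeomorphic to ℝ⁴ and embedded"; the open tropical manifold |K| ∖ v₀ carries extra integral-affine
structure.
- Literature.Barriers.SmoothPoincare4.LowGenusTrisectionBarrier, CircleActionBar

sub-problem: SmoothPoincare4 · status: draft · opened planner-plan-lens-SmoothPoincare4-rescuer-v2-g2-0 2026-08-16T16:34:38Z · rev 2 · ledger route-SmoothPoincare4-TropicalFanoSkeleton
GENERATED by the gate from the ledger (D-0016/17). Provers cite these decls: `theorem foo : Summit.SmoothPoincare4.SmoothPoincare4.Theses.TropicalFanoSkeleton.<Decl> := …` in Summits/SmoothPoincare4/SmoothPoincare4/Theorems/<Name>.lean.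
-/

namespace Summit.SmoothPoincare4.SmoothPoincare4.Theses.TropicalFanoSkeleton

open scoped BigOperators Topology Manifold Classical MeasureTheory ProbabilityTheory Matrix InnerProductSpace ComplexConjugate ContinuousMap
open Filter Set Function TopologicalSpace MeasureTheory

attribute [summit_statement] _root_.SmoothPoincare4

open Literature.SPC4

/-- item stmt-SmoothPoincare4-15643 · crux · rank 2 · open · by planner
why it might fail: Positive but NON-SIMPLE / non-polarisable data (the calibration has κ = 5) need not come from a degeneration (GS need simplicity + pre-polarisation + log structure, logmirror Thm 5.2/5.4); such data on M ∖ pt for some M ≄ S⁴ would refute the typed form while the AG chain survives.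
sources: GrossSiebert2011, FernexKollarXu2012, Loginov2019, FeltenFilipRuddat2021, Prince2019, arXiv:math/0309070
[crux] For every closed smooth 4-manifold M, every smooth triangulation K of M, every vertex v₀ and
every positive integral tropical fan datum x on (K, v₀) — integrality, x a a = 0, complete
projective unimodular simplicial fans at all vertices a ≠ v₀ (cones generated by the chart positions
x a w of the other vertices of each face, v₀ contributing its ray), and for every codimension-one
face ρ with cofaces σ⁺ ≠ σ⁻ and vertices a ≠ b of ρ (both ≠ v₀) the transition monodromy (chart a →
chart b through σ⁺, back through σ⁻) is y ↦ y + κ·ď_ρ(y)·(x a b) with κ ≥ 0, ď_ρ the primitive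
conormal of ρ positive on σ⁺ — M admits a skeleton certificate: a smooth triangulation K′ with a
vertex whose antistar simplicially collapses to a vertex. Plan: GS reconstruction → RC general fibre
→ dFKX Thm 41 → comparison (informal items FanoSmoothing, RcGeneralFibre, SkeletonComparison filed
after open). [difficulty: open-problem] -/
@[route_item "route-SmoothPoincare4-TropicalFanoSkeleton", crux]
def TropicalCollapse : Prop :=
  ∀ (M : Type) [TopologicalSpace M] [T2Space M] [SecondCountableTopology M] [ChartedSpace (EuclideanSpace ℝ (Fin 4)) M] [IsManifold (𝓡 4) (⊤ : ℕ∞) M], ∀ (N : ℕ) (K : Geometry.SimplicialComplex ℝ (EuclideanSpace ℝ (Fin N))) (h : K.space ≃ₜ M), Literature.Topology.FourManifolds.IsSmoothTriangulation 4 K h → ∀ v₀ : EuclideanSpace ℝ (Fin N), ({v₀} : Finset (EuclideanSpace ℝ (Fin N))) ∈ K.faces → ∀ x : EuclideanSpace ℝ (Fin N) → EuclideanSpace ℝ (Fin N) → (Fin 4 → ℝ), ((∀ a w i, ∃ z : ℤ, x a w i = z) ∧ (∀ a, x a a = 0) ∧ (∀ a : EuclideanSpace ℝ (Fin N), ({a}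 : Finset (EuclideanSpace ℝ (Fin N))) ∈ K.faces → a ≠ v₀ → (∀ σ ∈ K.faces, a ∈ σ → σ.card = 5 → ∀ f : Fin 4 → EuclideanSpace ℝ (Fin N), Function.Injective f → (∀ i, f i ∈ σ.erase a) → |Matrix.det (Matrix.of fun i j => x a (f i) j)| = 1) ∧ (∀ τ ∈ K.faces, ∀ τ' ∈ K.faces, a ∈ τ → a ∈ τ' → {y : Fin 4 → ℝ | ∃ c : EuclideanSpace ℝ (Fin N) → ℝ, (∀ w, 0 ≤ c w) ∧ y = ∑ w ∈ (τ).erase a, c w • x a w} ∩ {y : Fin 4 → ℝ | ∃ c : EuclideanSpace ℝ (Fin N) → ℝ, (∀ w, 0 ≤ c w) ∧ y = ∑ w ∈ (τ').erase a, c w • x a w} = {y : Fin 4 → ℝ | ∃ c : EuclideanSpace ℝ (Fin N) → ℝ, (∀ w, 0 ≤ c w) ∧ y = ∑ w ∈ (τ ∩ τ').erase a, c w • x a w}) ∧ (⋃ τ ∈ {τ ∈ K.faces | a ∈ τ}, {y : Fin 4 → ℝ | ∃ c : EuclideanSpace ℝ (Fin N) → ℝ, (∀ w, 0 ≤ c w)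 ∧ y = ∑ w ∈ (τ).erase a, c w • x a w}) = Set.univ ∧ (∃ m : Finset (EuclideanSpace ℝ (Fin N)) → (Fin 4 → ℝ), ∀ σ ∈ K.faces, ∀ σ' ∈ K.faces, a ∈ σ → a ∈ σ' → σ.card = 5 → σ'.card = 5 → ∀ y ∈ {y : Fin 4 → ℝ | ∃ c : EuclideanSpace ℝ (Fin N) → ℝ, (∀ w, 0 ≤ c w) ∧ y = ∑ w ∈ (σ).erase a, c w • x a w}, (∑ i, m σ' i * y i ≤ ∑ i, m σ i * y i) ∧ ((∑ i, m σ' i * y i = ∑ i, m σ i * y i) → y ∈ {y : Fin 4 → ℝ | ∃ c : EuclideanSpace ℝ (Fin N) → ℝ, (∀ w, 0 ≤ c w) ∧ y = ∑ w ∈ (σ').erase a, c w • x a w}))) ∧ (∀ ρ ∈ K.faces, ρ.card = 4 → ∀ σp ∈ K.faces, ∀ σm ∈ K.faces, σp.card = 5 → σm.card = 5 → ρ ⊆ σp → ρ ⊆ σm → σp ≠ σm → ∀ a ∈ ρ, ∀ b ∈ ρ, a ≠ b → a ≠ v₀ → b ≠ v₀ → ∀ ψp ψm : (Fin 4 → ℝ)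 →ᵃ[ℝ] (Fin 4 → ℝ), (∀ w ∈ σp, w ≠ v₀ → ψp (x a w) = x b w) → (v₀ ∈ σp → ψp.linear (x a v₀) = x b v₀) → (∀ w ∈ σm, w ≠ v₀ → ψm (x a w) = x b w) → (v₀ ∈ σm → ψm.linear (x a v₀) = x b v₀) → ∀ wp ∈ σp, wp ∉ ρ → ∀ g : Fin 3 → EuclideanSpace ℝ (Fin N), Function.Injective g → (∀ i, g i ∈ ρ.erase a) → ∃ κ : ℝ, 0 ≤ κ ∧ ∀ y : Fin 4 → ℝ, ψp y = ψm (y + (κ * Matrix.det (Matrix.of ![y, x a (g 0), x a (g 1), x a (g 2)]) * Matrix.det (Matrix.of ![x a wp, x a (g 0), x a (g 1), x a (g 2)])) • x a b))) → ∃ (N' : ℕ) (K' : Geometry.SimplicialComplex ℝ (EuclideanSpace ℝ (Fin N'))) (h' : K'.space ≃ₜ M), Literature.Topology.FourManifolds.IsSmoothTriangulation 4 K' h' ∧ ∃ v : EuclideanSpace ℝ (Fin N'), ({v} : Finset (EuclideanSpace ℝ (Fin N'))) ∈ K'.faces ∧ ∃ w : EuclideanSpace ℝ (Fin N'), Relation.ReflTransGen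 (fun F G : Set (Finset (EuclideanSpace ℝ (Fin N'))) => ∃ σ τ : Finset (EuclideanSpace ℝ (Fin N')), (σ ∈ F ∧ τ ∈ F ∧ σ ⊂ τ ∧ τ.card = σ.card + 1 ∧ ∀ ρ ∈ F, σ ⊂ ρ → ρ = τ) ∧ G = F \ {σ, τ}) {s ∈ K'.faces | v ∉ s} {({w} : Finset (EuclideanSpace ℝ (Fin N')))}

/-- item stmt-SmoothPoincare4-15644 · crux · rank 3 · open · by planner
why it might fail: Zero slack — with TropicalCollapse and recognition it implies SPC4, so a fake ball carries no such data; no mechanism yet produces fan data from a handle decomposition, and even for S⁴ only the ∂Δ⁵ / quintic-4-fold structure (κ = 5) is in hand.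
sources: GrossSiebert2011, arXiv:math/0309070, FernexKollarXu2012, MauriMoraga2024
[crux] Every smooth homotopy 4-sphere M admits a smooth triangulation K, a vertex v₀ and a positive
integral tropical fan datum x on (K, v₀) (same clauses as in TropicalCollapse). The existence half:
an existence-of-geometric-structure problem (integral affine structure with codimension-2
singularities and one conical end) on the punctured fake sphere; flexible away from the discriminant
(h-principle for affine immersions of open parallelisable 4-manifolds), rigid only through the
finite shear data. [difficulty: open-problem] -/
@[route_item "route-SmoothPoincare4-TropicalFanoSkeleton", crux]
def TropicalBall : Prop :=
  ∀ (M : Type) [TopologicalSpace M] [T2Space M] [SecondCountableTopology M] [ChartedSpace (EuclideanSpace ℝ (Fin 4)) M] [IsManifold (𝓡 4) (⊤ : ℕ∞) M], M ≃ₕ Metric.sphere (0 : EuclideanSpace ℝ (Fin 5)) 1 → ∃ (N : ℕ) (K : Geometry.SimplicialComplex ℝ (EuclideanSpace ℝ (Fin N))) (h : K.space ≃ₜ M), Literature.Topology.FourManifolds.IsSmoothTriangulation 4 K h ∧ ∃ v₀ : EuclideanSpace ℝ (Fin N), ({v₀} : Finset (EuclideanSpace ℝ (Fin N))) ∈ K.faces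 ∧ ∃ x : EuclideanSpace ℝ (Fin N) → EuclideanSpace ℝ (Fin N) → (Fin 4 → ℝ), ((∀ a w i, ∃ z : ℤ, x a w i = z) ∧ (∀ a, x a a = 0) ∧ (∀ a : EuclideanSpace ℝ (Fin N), ({a} : Finset (EuclideanSpace ℝ (Fin N))) ∈ K.faces → a ≠ v₀ → (∀ σ ∈ K.faces, a ∈ σ → σ.card = 5 → ∀ f : Fin 4 → EuclideanSpace ℝ (Fin N), Function.Injective f → (∀ i, f i ∈ σ.erase a) → |Matrix.det (Matrix.of fun i j => x a (f i) j)| = 1) ∧ (∀ τ ∈ K.faces, ∀ τ' ∈ K.faces, a ∈ τ → a ∈ τ' → {y : Fin 4 → ℝ | ∃ c : EuclideanSpace ℝ (Fin N) → ℝ, (∀ w, 0 ≤ c w) ∧ y = ∑ w ∈ (τ).erase a, c w • x a w} ∩ {y : Fin 4 → ℝ | ∃ c : EuclideanSpace ℝ (Fin N) → ℝ, (∀ w, 0 ≤ c w) ∧ y = ∑ w ∈ (τ').erase a, c w • x a w} = {y : Fin 4 → ℝ | ∃ c : EuclideanSpace ℝ (Fin N) → ℝ, (∀ w, 0 ≤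 c w) ∧ y = ∑ w ∈ (τ ∩ τ').erase a, c w • x a w}) ∧ (⋃ τ ∈ {τ ∈ K.faces | a ∈ τ}, {y : Fin 4 → ℝ | ∃ c : EuclideanSpace ℝ (Fin N) → ℝ, (∀ w, 0 ≤ c w) ∧ y = ∑ w ∈ (τ).erase a, c w • x a w}) = Set.univ ∧ (∃ m : Finset (EuclideanSpace ℝ (Fin N)) → (Fin 4 → ℝ), ∀ σ ∈ K.faces, ∀ σ' ∈ K.faces, a ∈ σ → a ∈ σ' → σ.card = 5 → σ'.card = 5 → ∀ y ∈ {y : Fin 4 → ℝ | ∃ c : EuclideanSpace ℝ (Fin N) → ℝ, (∀ w, 0 ≤ c w) ∧ y = ∑ w ∈ (σ).erase a, c w • x a w}, (∑ i, m σ' i * y i ≤ ∑ i, m σ i * y i) ∧ ((∑ i, m σ' i * y i = ∑ i, m σ i * y i) → y ∈ {y : Fin 4 → ℝ | ∃ c : EuclideanSpace ℝ (Fin N) → ℝ, (∀ w, 0 ≤ c w) ∧ y = ∑ w ∈ (σ').erase a, c w • x a w}))) ∧ (∀ ρ ∈ K.faces, ρ.card = 4 → ∀ σp ∈ K.faces,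 ∀ σm ∈ K.faces, σp.card = 5 → σm.card = 5 → ρ ⊆ σp → ρ ⊆ σm → σp ≠ σm → ∀ a ∈ ρ, ∀ b ∈ ρ, a ≠ b → a ≠ v₀ → b ≠ v₀ → ∀ ψp ψm : (Fin 4 → ℝ) →ᵃ[ℝ] (Fin 4 → ℝ), (∀ w ∈ σp, w ≠ v₀ → ψp (x a w) = x b w) → (v₀ ∈ σp → ψp.linear (x a v₀) = x b v₀) → (∀ w ∈ σm, w ≠ v₀ → ψm (x a w) = x b w) → (v₀ ∈ σm → ψm.linear (x a v₀) = x b v₀) → ∀ wp ∈ σp, wp ∉ ρ → ∀ g : Fin 3 → EuclideanSpace ℝ (Fin N), Function.Injective g → (∀ i, g i ∈ ρ.erase a) → ∃ κ : ℝ, 0 ≤ κ ∧ ∀ y : Fin 4 → ℝ, ψp y = ψm (y + (κ * Matrix.det (Matrix.of ![y, x a (g 0), x a (g 1), x a (g 2)]) * Matrix.det (Matrix.of ![x a wp, x a (g 0), x a (g 1), x a (g 2)])) • x a b)))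

-- item stmt-SmoothPoincare4-15691 · crux · rank 4 · open · by planner — informal only, no Lean statement yet:
--   [crux] FANO SMOOTHING (the realisation bridge; informal until definition requests D-trop / D2 land):
--   positive integral tropical fan data x on (K, v₀) — K a smooth triangulation of a closed 4-manifold,
--   the typed datum of TropicalCollapse — together with GS simplicity (arXiv:math/0309070 Def 1.60;
--   local rigidity) and a multivalued pre-polarisation determine a pre-polarised positive locally rigid
--   toric log Calabi–Yau space X₀ over ℂ (fan picture: components X_a = toric variety of the vertex fan
--   at a ≠ v₀, glued along the cells of K not containing v₀; the cells containing v₀ are the unbounded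
--   cell

-- item stmt-SmoothPoincare4-15692 · crux · rank 5 · open · by planner — informal only, no Lean statement yet:
--   [crux] RC GENERAL FIBRE (informal until D2): in the situation of FanoSmoothing — a projective toric
--   degeneration 𝔛 → Spec ℂ⟦t⟧ (or over a pointed curve after approximation) arising from positive
--   tropical fan data on (K, v₀) with K a smooth triangulation of a closed 4-manifold, so that the dual
--   intersection complex B = |K| ∖ v₀ has ONE conical end over lk(v₀) = S³ and bounded core =
--   antistar(v₀) — the geometric general fibre X_η̄ is RATIONALLY CONNECTED (equivalently, by Zhang/HM,
--   it suffices that X_η̄ be of Fano type). This is exactly the hypothesis of FernexKollarXu2012 Thm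
--   4/41. Why it might

-- item stmt-SmoothPoincare4-15693 · crux · rank 6 · open · by planner — informal only, no Lean statement yet:
--   [crux] SKELETON COMPARISON + COLLAPSE TRANSPORT (informal until D2): for the degeneration of
--   FanoSmoothing with RC general fibre (RcGeneralFibre), (a) after algebraisation over a smooth pointed
--   curve (or running the relative MMP over the DVR) the pair (𝔛, red 𝔛₀) admits a qdlt (toroidal) model
--   whose dFKX dual complex is PL-homeomorphic — in fact equal after subdivision — to the antistar {s ∈
--   K | v₀ ∉ s}; (b) hence by FernexKollarXu2012 Thm 41 (proof p.14: (K+Δ)-MMP over C terminates in a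
--   Fano contraction by BCHM since K is not pseudo-effective; Cor 22 makes every step a collapse because
--   the fi

/-- item stmt-SmoothPoincare4-15645 · crux · rank 9 · open · by planner
why it might fail: Hypothesis of `closes`; known on paper (Whitehead 1939, Alexander, PL=DIFF) but theory-sized to formalise (regular neighbourhoods / collapsing for Euclidean complexes, PL→DIFF smoothing, none in Mathlib); if IsSmoothTriangulation were weaker than Whitehead compatibility it could fail as stated.
sources: Whitehead1939, RourkeSanderson1972, HirschMazur1974, Lange2016, Whitehead1940
[support] RECOGNITION (known; verbatim the LogCYSkeleton item stmt-SmoothPoincare4-13642): a smooth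
4-manifold smoothly triangulated by a finite complex with a vertex whose antistar simplicially
collapses to a vertex is diffeomorphic to S⁴ (Whitehead: collapsible combinatorial manifold = PL
ball; cone on the PL 3-sphere link = ball; Alexander; PL = DIFF in dimension 4). [difficulty: XL] -/
@[route_item "route-SmoothPoincare4-TropicalFanoSkeleton", crux]
def CertificateRecognition : Prop :=
  ∀ (M : Type) [TopologicalSpace M] [T2Space M] [SecondCountableTopology M] [ChartedSpace (EuclideanSpace ℝ (Fin 4)) M] [IsManifold (𝓡 4) (⊤ : ℕ∞) M], (∃ (N : ℕ) (K : Geometry.SimplicialComplex ℝ (EuclideanSpace ℝ (Fin N))) (h : K.space ≃ₜ M), Literature.Topology.FourManifolds.IsSmoothTriangulation 4 K h ∧ ∃ v : EuclideanSpace ℝ (Fin N), ({v} : Finset (EuclideanSpace ℝ (Fin N))) ∈ K.faces ∧ ∃ w : EuclideanSpace ℝ (Fin N), Relation.ReflTransGen (fun F G : Set (Finset (EuclideanSpace ℝ (Fin N))) => ∃ σ τ : Finset (EuclideanSpace ℝ (Fin N)), (σ ∈ F ∧ τ ∈ F ∧ σ ⊂ τ ∧ τ.card = σ.card + 1 ∧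 ∀ ρ ∈ F, σ ⊂ ρ → ρ = τ) ∧ G = F \ {σ, τ}) {s ∈ K.faces | v ∉ s} {({w} : Finset (EuclideanSpace ℝ (Fin N)))}) → Nonempty (Diffeomorph (𝓡 4) (𝓡 4) M (Metric.sphere (0 : EuclideanSpace ℝ (Fin 5)) 1) (⊤ : ℕ∞))

/-- item stmt-SmoothPoincare4-15646 · support · rank 9 · open · by planner
sources: GrossSiebert2011, Whitehead1940, MauriMoraga2024
[support] CALIBRATION / non-vacuity: the round S⁴ carries positive integral tropical fan data — K =
∂Δ⁵ radially projected (the smooth triangulation of SimplexBoundaryCertificate,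
stmt-SmoothPoincare4-13643), v₀ any vertex, and at each other vertex the fan of ℙ⁴ (the four core
neighbours ↦ e₁,…,e₄, v₀ ↦ −Σeᵢ); all transition monodromies are shears with κ = 5 ≥ 0 (checked by
hand for both types of codimension-one faces; it is the toric degeneration t·f₅ + u₀⋯u₄ = 0 of
quintic 4-folds with D = {u₅ = 0} a quintic Calabi–Yau 3-fold ↔ lk(v₀) = S³). [difficulty: L] -/
@[route_item "route-SmoothPoincare4-TropicalFanoSkeleton"]
def SimplexTropicalCalibration : Prop :=
  ∃ (N : ℕ) (K : Geometry.SimplicialComplex ℝ (EuclideanSpace ℝ (Fin N))) (h : K.space ≃ₜ Metric.sphere (0 : EuclideanSpace ℝ (Fin 5)) 1), Literature.Topology.FourManifolds.IsSmoothTriangulation 4 K h ∧ ∃ v₀ : EuclideanSpace ℝ (Fin N), ({v₀} : Finset (EuclideanSpace ℝ (Fin N))) ∈ K.faces ∧ ∃ x : EuclideanSpace ℝ (Fin N) → EuclideanSpace ℝ (Fin N) → (Fin 4 → ℝ), ((∀ a w i, ∃ z : ℤ, x a w i = z) ∧ (∀ a, x a a = 0) ∧ (∀ a : EuclideanSpace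 ℝ (Fin N), ({a} : Finset (EuclideanSpace ℝ (Fin N))) ∈ K.faces → a ≠ v₀ → (∀ σ ∈ K.faces, a ∈ σ → σ.card = 5 → ∀ f : Fin 4 → EuclideanSpace ℝ (Fin N), Function.Injective f → (∀ i, f i ∈ σ.erase a) → |Matrix.det (Matrix.of fun i j => x a (f i) j)| = 1) ∧ (∀ τ ∈ K.faces, ∀ τ' ∈ K.faces, a ∈ τ → a ∈ τ' → {y : Fin 4 → ℝ | ∃ c : EuclideanSpace ℝ (Fin N) → ℝ, (∀ w, 0 ≤ c w) ∧ y = ∑ w ∈ (τ).erase a, c w • x a w} ∩ {y : Fin 4 → ℝ | ∃ c : EuclideanSpace ℝ (Fin N) → ℝ, (∀ w, 0 ≤ c w) ∧ y = ∑ w ∈ (τ').erase a, c w • x a w} = {y : Fin 4 → ℝ | ∃ c : EuclideanSpace ℝ (Fin N) → ℝ, (∀ w, 0 ≤ c w) ∧ y = ∑ w ∈ (τ ∩ τ').erase a, c w • x a w}) ∧ (⋃ τ ∈ {τ ∈ K.faces | a ∈ τ}, {y : Fin 4 → ℝ | ∃ c : EuclideanSpace ℝ (Fin N) → ℝ, (∀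 w, 0 ≤ c w) ∧ y = ∑ w ∈ (τ).erase a, c w • x a w}) = Set.univ ∧ (∃ m : Finset (EuclideanSpace ℝ (Fin N)) → (Fin 4 → ℝ), ∀ σ ∈ K.faces, ∀ σ' ∈ K.faces, a ∈ σ → a ∈ σ' → σ.card = 5 → σ'.card = 5 → ∀ y ∈ {y : Fin 4 → ℝ | ∃ c : EuclideanSpace ℝ (Fin N) → ℝ, (∀ w, 0 ≤ c w) ∧ y = ∑ w ∈ (σ).erase a, c w • x a w}, (∑ i, m σ' i * y i ≤ ∑ i, m σ i * y i) ∧ ((∑ i, m σ' i * y i = ∑ i, m σ i * y i) → y ∈ {y : Fin 4 → ℝ | ∃ c : EuclideanSpace ℝ (Fin N) → ℝ, (∀ w, 0 ≤ c w) ∧ y = ∑ w ∈ (σ').erase a, c w • x a w}))) ∧ (∀ ρ ∈ K.faces, ρ.card = 4 → ∀ σp ∈ K.faces, ∀ σm ∈ K.faces, σp.card = 5 → σm.card = 5 → ρ ⊆ σp → ρ ⊆ σm → σp ≠ σm → ∀ a ∈ ρ, ∀ b ∈ ρ, a ≠ b → a ≠ v₀ → b ≠ v₀ → ∀ ψp ψm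 : (Fin 4 → ℝ) →ᵃ[ℝ] (Fin 4 → ℝ), (∀ w ∈ σp, w ≠ v₀ → ψp (x a w) = x b w) → (v₀ ∈ σp → ψp.linear (x a v₀) = x b v₀) → (∀ w ∈ σm, w ≠ v₀ → ψm (x a w) = x b w) → (v₀ ∈ σm → ψm.linear (x a v₀) = x b v₀) → ∀ wp ∈ σp, wp ∉ ρ → ∀ g : Fin 3 → EuclideanSpace ℝ (Fin N), Function.Injective g → (∀ i, g i ∈ ρ.erase a) → ∃ κ : ℝ, 0 ≤ κ ∧ ∀ y : Fin 4 → ℝ, ψp y = ψm (y + (κ * Matrix.det (Matrix.of ![y, x a (g 0), x a (g 1), x a (g 2)]) * Matrix.det (Matrix.of ![x a wp, x a (g 0), x a (g 1), x a (g 2)])) • x a b)))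

/-- item stmt-SmoothPoincare4-15647 · assembly · rank 1 · open · by planner
sources: Whitehead1939, FernexKollarXu2012
[assembly] TropicalBall → TropicalCollapse → CertificateRecognition → SmoothPoincare4. -/
@[route_item "route-SmoothPoincare4-TropicalFanoSkeleton"]
def Assembly : Prop :=
  TropicalBall → TropicalCollapse → CertificateRecognition → _root_.SmoothPoincare4

/-! D-0027 §2.1 — DECIDING THEOREM (planner-authored via `route open/edit --closes-file`; by planner-plan-lens-SmoothPoincare4-rescuer-v2-g2-0 2026-08-16T16:34:38Z):
its hypotheses are this route's items and its conclusion the sub-problem Statement (glue_lint), and it elaborates with this file. -/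

@[closes "route-SmoothPoincare4-TropicalFanoSkeleton"] theorem closes (hTB : TropicalBall) (hTC : TropicalCollapse) (hR : CertificateRecognition) :
    _root_.SmoothPoincare4 := by
  intro M _ _ _ _ _ e
  obtain ⟨N, K, h, hK, v₀, hv₀, x, hx⟩ := hTB M e
  exact hR M (hTC M N K h hK v₀ hv₀ x hx)

end Summit.SmoothPoincare4.SmoothPoincare4.Theses.TropicalFanoSkeleton
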